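import Literature.AnabelianGeometry.SemiGraphs.ThetaRayEscapeMaximalCompact
import Literature.AnabelianGeometry.SemiGraphs.TemperedGalFiniteSubgroupsBounded
import HarnessLib

/-!
# Thm 3.7 (iv) at `𝒢_θ` from the level data of the escape ALONE (REFUTE-F1732, (iv) row, binder `hbd` discharged)

Mochizuki, *Semi-graphs of anabelioids*, Publ. RIMS **42** (2006), §3, Thm. 3.7 (iv) p. 41
[cite: MochizukiSemiAnbd2006, Thm 3.7(iv) p.41]; print proves the FINITE-`𝔾` case (kernel: p431007).
FRONTIER programme REFUTE-F1732 (plan/L3/SUBDAG-SemiAnbd-Thm37iii-REFUTE.md; honest framing α59).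

PROOF-ONLY ADDITIVE sequel (abc-iut-w6-d120) of `ThetaRayEscapeMaximalCompact.lean` (p440637): the one extra
binder `hbd` («finite subgroups of the level groups `Gal(𝒢_{∞,n}/𝒢)` have bounded order») is DISCHARGED by
abc-iut-L3-t6's `ProfiniteSemiGraph.hbd_galoisLevelData` (p440571: a finite subgroup fixes a tree vertex or
edge — `SemiGraph.ncard_le_of_finite_of_treeAction` — and stabilisers inject into the finite level fibres), so
`¬ MaximalCompactIffVerticial.{0}` (F-1750) and its At-form at `𝒢_θ` follow from EXACTLY the level-wise
binders (hz) (hfin) (hfar) (hcrit) of abc-iut-L3-d4's (iii) closer p438249 — the (iii) and (iv) rows of the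
junction now have identical hypotheses.  NEGATIVE-MODULO form; nothing here bears on [IUTchIII] Cor. 3.12.
-/

namespace Literature.AnabelianGeometry.SemiGraphs

namespace ProfiniteSemiGraph

open CategoryTheory Topology

section ThetaRayEscapeIVFree

variable {G E : Type} [Group G] [TopologicalSpace G] [IsTopologicalGroup G] [CompactSpace G]
  [TotallyDisconnectedSpace G] [Group E] [TopologicalSpace E] [IsTopologicalGroup E] [CompactSpace E]
  [TotallyDisconnectedSpace E] {up : E →ₜ* G} {low : ℕ → (E →ₜ* G)}

/-- **`¬ MaximalCompactIffVerticial.{0}` from the level data of the escape alone** (hbd discharged by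
`hbd_galoisLevelData`). NEGATIVE-MODULO form. [cite: MochizukiSemiAnbd2006, Thm 3.7(iv) p.41] -/
theorem thetaRay_not_maximalCompactIffVerticial_of_levelEscape'
    (h37 : (thetaRay G E up low).Thm37Hypotheses)
    (z : ℕ → (thetaRay G E up low).temperedPi h37.toProp36Hypotheses)
    (hz : ∀ j : ℕ, ∃ N : ℕ, ∀ k, N ≤ k →
      ((thetaRay G E up low).galoisLevelData h37.toProp36Hypotheses).proj h37.isCountable j (z (k + 1)) =
        ((thetaRay G E up low).galoisLevelData h37.toProp36Hypotheses).proj h37.isCountable j (z k))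
    (hfin : ∀ j k : ℕ, IsOfFinOrder
      (((thetaRay G E up low).galoisLevelData h37.toProp36Hypotheses).proj h37.isCountable j (z k)))
    (hfar : ∀ k j : ℕ, ∃ x : (((thetaRay G E up low).galoisLevelData h37.toProp36Hypotheses).tree j).Vertex,
      k ≤ (((thetaRay G E up low).galoisLevelData h37.toProp36Hypotheses).treeProj j).vertexMap x ∧
        (((thetaRay G E up low).galoisLevelData h37.toProp36Hypotheses).treeAct h37.isCountable j
          (z k)).hom.vertexMap x = x)
    (hcrit : ∀ n : ℕ, ∃ j₀ : ℕ, ∀ j, j₀ ≤ j → ∃ N : ℕ, ∀ k, N ≤ k →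
      ∀ (y : (((thetaRay G E up low).galoisLevelData h37.toProp36Hypotheses).tree j).Vertex)
        (b b' : (((thetaRay G E up low).galoisLevelData h37.toProp36Hypotheses).tree j).Branch),
        (((thetaRay G E up low).galoisLevelData h37.toProp36Hypotheses).tree j).abuts b = some y →
        (((thetaRay G E up low).galoisLevelData h37.toProp36Hypotheses).tree j).abuts b' = some y →
        (((thetaRay G E up low).galoisLevelData h37.toProp36Hypotheses).treeProj j).vertexMap y = n + 1 →
        (((thetaRay G E up low).galoisLevelData h37.toProp36Hypotheses).treeAct h37.isCountable j
            (z k)).hom.edgeMap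
          ((((thetaRay G E up low).galoisLevelData h37.toProp36Hypotheses).tree j).edgeOf b) =
          (((thetaRay G E up low).galoisLevelData h37.toProp36Hypotheses).tree j).edgeOf b →
        (((thetaRay G E up low).galoisLevelData h37.toProp36Hypotheses).treeAct h37.isCountable j
            (z k)).hom.edgeMap
          ((((thetaRay G E up low).galoisLevelData h37.toProp36Hypotheses).tree j).edgeOf b') =
          (((thetaRay G E up low).galoisLevelData h37.toProp36Hypotheses).tree j).edgeOf b' →
        (∃ (b₂ : (((thetaRay G E up low).galoisLevelData h37.toProp36Hypotheses).tree j).Branch)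
           (v₂ : (((thetaRay G E up low).galoisLevelData h37.toProp36Hypotheses).tree j).Vertex), b₂ ≠ b ∧
          (((thetaRay G E up low).galoisLevelData h37.toProp36Hypotheses).tree j).edgeOf b₂ =
            (((thetaRay G E up low).galoisLevelData h37.toProp36Hypotheses).tree j).edgeOf b ∧
          (((thetaRay G E up low).galoisLevelData h37.toProp36Hypotheses).tree j).abuts b₂ = some v₂ ∧
          (((thetaRay G E up low).galoisLevelData h37.toProp36Hypotheses).treeProj j).vertexMap v₂ =
            n + 2) →
        (∃ (b₂ : (((thetaRay G E up low).galoisLevelData h37.toProp36Hypotheses).tree j).Branch)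
           (v₂ : (((thetaRay G E up low).galoisLevelData h37.toProp36Hypotheses).tree j).Vertex), b₂ ≠ b' ∧
          (((thetaRay G E up low).galoisLevelData h37.toProp36Hypotheses).tree j).edgeOf b₂ =
            (((thetaRay G E up low).galoisLevelData h37.toProp36Hypotheses).tree j).edgeOf b' ∧
          (((thetaRay G E up low).galoisLevelData h37.toProp36Hypotheses).tree j).abuts b₂ = some v₂ ∧
          (((thetaRay G E up low).galoisLevelData h37.toProp36Hypotheses).treeProj j).vertexMap v₂ = n) →
        False) :
    ¬ MaximalCompactIffVerticial.{0} :=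
  thetaRay_not_maximalCompactIffVerticial_of_levelEscape h37 z hz hfin hfar hcrit
    (hbd_galoisLevelData (thetaRay G E up low) h37.toProp36Hypotheses)

/-- **`¬ MaximalCompactIffVerticialAt 𝒢_θ` from the level data of the escape alone.** NEGATIVE-MODULO form.
[cite: MochizukiSemiAnbd2006, Thm 3.7(iv) p.41] -/
theorem thetaRay_not_maximalCompactIffVerticialAt_of_levelEscape'
    (h37 : (thetaRay G E up low).Thm37Hypotheses)
    (z : ℕ → (thetaRay G E up low).temperedPi h37.toProp36Hypotheses)
    (hz : ∀ j : ℕ, ∃ N : ℕ, ∀ k, N ≤ k →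
      ((thetaRay G E up low).galoisLevelData h37.toProp36Hypotheses).proj h37.isCountable j (z (k + 1)) =
        ((thetaRay G E up low).galoisLevelData h37.toProp36Hypotheses).proj h37.isCountable j (z k))
    (hfin : ∀ j k : ℕ, IsOfFinOrder
      (((thetaRay G E up low).galoisLevelData h37.toProp36Hypotheses).proj h37.isCountable j (z k)))
    (hfar : ∀ k j : ℕ, ∃ x : (((thetaRay G E up low).galoisLevelData h37.toProp36Hypotheses).tree j).Vertex,
      k ≤ (((thetaRay G E up low).galoisLevelData h37.toProp36Hypotheses).treeProj j).vertexMap x ∧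
        (((thetaRay G E up low).galoisLevelData h37.toProp36Hypotheses).treeAct h37.isCountable j
          (z k)).hom.vertexMap x = x)
    (hcrit : ∀ n : ℕ, ∃ j₀ : ℕ, ∀ j, j₀ ≤ j → ∃ N : ℕ, ∀ k, N ≤ k →
      ∀ (y : (((thetaRay G E up low).galoisLevelData h37.toProp36Hypotheses).tree j).Vertex)
        (b b' : (((thetaRay G E up low).galoisLevelData h37.toProp36Hypotheses).tree j).Branch),
        (((thetaRay G E up low).galoisLevelData h37.toProp36Hypotheses).tree j).abuts b = some y →
        (((thetaRay G E up low).galoisLevelData h37.toProp36Hypotheses).tree j).abuts b' = some y →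
        (((thetaRay G E up low).galoisLevelData h37.toProp36Hypotheses).treeProj j).vertexMap y = n + 1 →
        (((thetaRay G E up low).galoisLevelData h37.toProp36Hypotheses).treeAct h37.isCountable j
            (z k)).hom.edgeMap
          ((((thetaRay G E up low).galoisLevelData h37.toProp36Hypotheses).tree j).edgeOf b) =
          (((thetaRay G E up low).galoisLevelData h37.toProp36Hypotheses).tree j).edgeOf b →
        (((thetaRay G E up low).galoisLevelData h37.toProp36Hypotheses).treeAct h37.isCountable j
            (z k)).hom.edgeMap
          ((((thetaRay G E up low).galoisLevelData h37.toProp36Hypotheses).tree j).edgeOf b') =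
          (((thetaRay G E up low).galoisLevelData h37.toProp36Hypotheses).tree j).edgeOf b' →
        (∃ (b₂ : (((thetaRay G E up low).galoisLevelData h37.toProp36Hypotheses).tree j).Branch)
           (v₂ : (((thetaRay G E up low).galoisLevelData h37.toProp36Hypotheses).tree j).Vertex), b₂ ≠ b ∧
          (((thetaRay G E up low).galoisLevelData h37.toProp36Hypotheses).tree j).edgeOf b₂ =
            (((thetaRay G E up low).galoisLevelData h37.toProp36Hypotheses).tree j).edgeOf b ∧
          (((thetaRay G E up low).galoisLevelData h37.toProp36Hypotheses).tree j).abuts b₂ = some v₂ ∧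
          (((thetaRay G E up low).galoisLevelData h37.toProp36Hypotheses).treeProj j).vertexMap v₂ =
            n + 2) →
        (∃ (b₂ : (((thetaRay G E up low).galoisLevelData h37.toProp36Hypotheses).tree j).Branch)
           (v₂ : (((thetaRay G E up low).galoisLevelData h37.toProp36Hypotheses).tree j).Vertex), b₂ ≠ b' ∧
          (((thetaRay G E up low).galoisLevelData h37.toProp36Hypotheses).tree j).edgeOf b₂ =
            (((thetaRay G E up low).galoisLevelData h37.toProp36Hypotheses).tree j).edgeOf b' ∧
          (((thetaRay G E up low).galoisLevelData h37.toProp36Hypotheses).tree j).abuts b₂ = some v₂ ∧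
          (((thetaRay G E up low).galoisLevelData h37.toProp36Hypotheses).treeProj j).vertexMap v₂ = n) →
        False) :
    ¬ MaximalCompactIffVerticialAt (thetaRay G E up low) :=
  thetaRay_not_maximalCompactIffVerticialAt_of_levelEscape h37 z hz hfin hfar hcrit
    (hbd_galoisLevelData (thetaRay G E up low) h37.toProp36Hypotheses)

end ThetaRayEscapeIVFree

end ProfiniteSemiGraph

end Literature.AnabelianGeometry.SemiGraphs
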